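import Summits.ValiantsHypothesis.ValiantsHypothesis.Theorems.KPlusLogSqLawTropicalBBoundarySectorDefs

/-!
# Route «KPlusLogSqLaw», crux `TropicalB` (stmt-ValiantsHypothesis-19771) — boundary-type sector: MONOTONICITY IN THE NUMBER OF
# BOUNDARIES (`BoundaryVertexLaw (B+1) e → BoundaryVertexLaw B e`)

HONEST FRAMING.  Helper toward the registered stubs of `Cruxes/TropicalB/Lines/birth.lean` (crux
`Summit.ValiantsHypothesis.ValiantsHypothesis.Theses.KPlusLogSqLaw.TropicalB`, item `stmt-ValiantsHypothesis-19771`, route `KPlusLogSqLaw`,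
DRAFT; cell `pub-symmetroid`, seat val-sym-trop-p1 g2).  Plumbing for `BoundarySector.BoundaryVertexLaw` (file `…BoundarySectorDefs`,
p447010): a boundary-type design with `B` boundaries is also a boundary-type design with `B + 1` boundaries (append a dummy boundary and
let the labelling ignore its bit), so a vertex law for `B + 1` boundaries implies the same law for `B` boundaries
(`boundaryVertexLaw_of_succ`, `boundaryVertexLaw_of_le`).  Hence the trop-p2 successor's target `BoundaryVertexLaw 2 2` covers every
`B ≤ 2`.  Nothing here is in-window; nothing bears on `TropicalB`, `KPlusLogSqLaw`, `Lifting`, DoorA26 / DoorA34, `MatrixDescartes`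
(`stmt-ValiantsHypothesis-18050`) or VP ≠ VNP.  [folklore]
-/

-- `Summit.ValiantsHypothesis.ValiantsHypothesis.…` repeats a component by the D-0017 layout
-- (single-conjunct summit), which the `dupNamespace` linter flags; the name is mandated.
set_option linter.dupNamespace false
set_option autoImplicit false

namespace Summit.ValiantsHypothesis.ValiantsHypothesis.Theorems.KPlusLogSqLaw

open Summit.ValiantsHypothesis.ValiantsHypothesis.Theorems.MatrixDescartes.Negative
open Finset

namespace BoundarySector

variable {m K B : ℕ}

/-- Appending a dummy boundary: the pattern of the extended orders restricted to the old indices is the old pattern. [folklore] -/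
theorem pattern_snoc_castSucc (π ρ : Fin B → Equiv.Perm (Fin m)) (α β : Equiv.Perm (Fin m)) (a b : Fin m) (j : Fin B) :
    pattern (Fin.snoc π α : Fin (B + 1) → Equiv.Perm (Fin m)) (Fin.snoc ρ β) a b (Fin.castSucc j) = pattern π ρ a b j := by
  simp [pattern, Fin.snoc_castSucc]

/-- A boundary-type design with `B` boundaries is a boundary-type design with `B + 1` boundaries for the extended orders and the
labelling that ignores the new bit. [folklore] -/
theorem isBoundaryDesign_snoc {π ρ : Fin B → Equiv.Perm (Fin m)} {lab : (Fin B → Bool) → Fin K}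
    {ε : Fin m → Fin m → Fin K → ℤ} (hε : IsBoundaryDesign π ρ lab ε) (α β : Equiv.Perm (Fin m)) :
    IsBoundaryDesign (Fin.snoc π α : Fin (B + 1) → Equiv.Perm (Fin m)) (Fin.snoc ρ β)
      (fun P => lab fun j => P (Fin.castSucc j)) ε := by
  intro a b l
  have e : (fun j => pattern (Fin.snoc π α : Fin (B + 1) → Equiv.Perm (Fin m)) (Fin.snoc ρ β) a b (Fin.castSucc j)) =
      pattern π ρ a b := funext fun j => pattern_snoc_castSucc π ρ α β a b j
  show ε a b l ≠ 0 ↔ l = lab (fun j => pattern (Fin.snoc π α : Fin (B + 1) → Equiv.Perm (Fin m)) (Fin.snoc ρ β) a b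
    (Fin.castSucc j))
  rw [e]
  exact hε a b l

/-- **Monotonicity in the number of boundaries**: a vertex law for `B + 1` boundaries implies the same law for `B` boundaries (same
exponent, same constant). [folklore] -/
theorem boundaryVertexLaw_of_succ {e : ℕ} (h : BoundaryVertexLaw (B + 1) e) : BoundaryVertexLaw B e := by
  classical
  obtain ⟨C, hC⟩ := h
  refine ⟨C, fun m K π ρ lab d v ε hε => ?_⟩
  exact hC m K (Fin.snoc π 1) (Fin.snoc ρ 1) (fun P => lab fun j => P (Fin.castSucc j)) d v ε (isBoundaryDesign_snoc hε 1 1)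

/-- `BoundaryVertexLaw B' e → BoundaryVertexLaw B e` for `B ≤ B'`. [folklore] -/
theorem boundaryVertexLaw_of_le {B B' e : ℕ} (hBB' : B ≤ B') (h : BoundaryVertexLaw B' e) : BoundaryVertexLaw B e := by
  induction B', hBB' using Nat.le_induction with
  | base => exact h
  | succ B' _ ih => exact ih (boundaryVertexLaw_of_succ h)

end BoundarySector

end Summit.ValiantsHypothesis.ValiantsHypothesis.Theorems.KPlusLogSqLaw
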